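import Literature.Geometry.Riemannian.PerelmanEntropy
import Literature.Geometry.Riemannian.CutLocusProofs
import Mathlib.MeasureTheory.Integral.Layercake
import HarnessLib

/-!
# Radial integrals on a closed Riemannian manifold under small-ball volume comparison

Let `(M, g)` be a closed connected Riemannian manifold modelled on `ℝᵐ`, `z ∈ M`, and suppose the
small distance balls around `z` are at most `(1 + ε)` times Euclidean in volume,
`Vol_g B_g(z, r) ≤ (1 + ε) |B(0, r)|` for `0 < r ≤ r₀`. Then for every antitone continuous
`F ≥ 0` with `v ↦ F(|v|)` Lebesgue integrable on `ℝᵐ`,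

  `∫_M F(d_g(z, y)) dV_g(y) ≤ (1 + ε) ∫_{ℝᵐ} F(|v|) dv + Vol_g(M) F(r₀)`

(`integral_comp_edist_le_of_ball_le`). This is the pure measure theory behind the universal upper
bound of the Gaussian integral `∫_M exp(−d²(z, y)/2σ²) dV_g(y)` entering the kernel Nash entropy of
Bamler 2020a (take `F(r) = exp(−r²/2σ²)`).

## Proof

Split `M` into `B = {d(z, ·) < r₀}` and its complement. On `Bᶜ`, `F(d) ≤ F(r₀)` (antitone), which
contributes at most `Vol(M) F(r₀)`. On `B` use the layer-cake formula
(`MeasureTheory.lintegral_eq_lintegral_meas_lt`) for `f = 𝟙_B · F ∘ d`: for `t > 0` the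
superlevel set `{f > t}` is `{d < c_t}` for some `c_t ≤ r₀`, because `{ρ ≥ 0 | F ρ > t, ρ < r₀}`
is an initial segment `[0, c_t)` of `[0, ∞)` (`exists_forall_lt_and_lt_iff_lt`: antitone +
continuous); by hypothesis `Vol_g{d < c_t} ≤ (1 + ε) |B(0, c_t)|`, and
`B(0, c_t) ⊆ {v | F(|v|) > t}`; integrating in `t` and using the layer-cake formula backwards on
`ℝᵐ` gives `∫_B F ∘ d ≤ (1 + ε) ∫ F(|v|) dv`. Connectedness makes `d(z, ·)` finite, so that the
real-valued distance `(g.edist hg z ·).toReal` has the distance balls as its sublevel sets.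

## References

* R. H. Bamler, *Entropy and heat kernel bounds on a Ricci flow background*, arXiv:2008.07093
  (2020), §5 (upper bounds of the pointed Nash entropy via Gaussian integrals). [Bamler2020Entropy]
* E. H. Lieb, M. Loss, *Analysis*, 2nd ed., AMS 2001, Thm. 1.13 (layer-cake representation).
-/

noncomputable section

open Set Filter Function MeasureTheory Measure
open scoped Manifold ContDiff Topology ENNReal NNReal

namespace Literature.Geometry.Riemannian

open Lorentzian Lorentzian.PseudoRiemannianMetric

/-- **Truncated superlevel sets of an antitone continuous function are initial segments**: for
`F` antitone and continuous, `t ∈ ℝ` and `r₀ ≥ 0` there is `c ≤ r₀` with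
`{ρ ≥ 0 | t < F ρ ∧ ρ < r₀} = {ρ ≥ 0 | ρ < c}`. [folklore] -/
theorem exists_forall_lt_and_lt_iff_lt {F : ℝ → ℝ} (hF : Antitone F) (hFc : Continuous F)
    (t : ℝ) {r₀ : ℝ} (hr₀ : 0 ≤ r₀) :
    ∃ c ≤ r₀, ∀ ρ, 0 ≤ ρ → ((t < F ρ ∧ ρ < r₀) ↔ ρ < c) := by
  by_cases h1 : ∀ ρ, t < F ρ
  · exact ⟨r₀, le_rfl, fun ρ _ ↦ by simp [h1 ρ]⟩
  obtain ⟨ρ₁, hρ₁⟩ := not_forall.1 h1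
  set T : Set ℝ := {ρ | F ρ ≤ t} with hT
  have hTne : T.Nonempty := ⟨ρ₁, not_lt.1 hρ₁⟩
  have hTc : IsClosed T := isClosed_le hFc continuous_const
  by_cases h2 : BddBelow T
  · have hbT : F (sInf T) ≤ t := hTc.csInf_mem hTne h2
    refine ⟨min (sInf T) r₀, min_le_right _ _, fun ρ _ ↦ ⟨fun h ↦ lt_min ?_ h.2,
      fun h ↦ ⟨?_, lt_of_lt_of_le h (min_le_right _ _)⟩⟩⟩
    · by_contra hle
      exact lt_irrefl t (h.1.trans_le ((hF (not_lt.1 hle)).trans hbT))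
    · by_contra hle
      have hb : sInf T ≤ ρ := csInf_le h2 (not_lt.1 hle)
      exact not_lt.2 hb (lt_of_lt_of_le h (min_le_left _ _))
  · refine ⟨0, hr₀, fun ρ hρ ↦ ⟨fun h ↦ (h2 ⟨ρ, fun ρ' hρ' ↦ ?_⟩).elim,
      fun h ↦ absurd h (not_lt.2 hρ)⟩⟩
    by_contra hlt
    exact lt_irrefl t (h.1.trans_le ((hF (le_of_not_ge hlt)).trans hρ'))

/-- **Radial integrals under small-ball volume comparison.** On a closed connected Riemannian
manifold `(M, g)`, if `Vol_g {d(z, ·) < r} ≤ (1 + ε) |B(0, r)|` for `0 < r ≤ r₀`, then for every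
antitone continuous `F ≥ 0` with `F(|·|)` Lebesgue integrable on `ℝᵐ`,
`∫_M F(d(z, y)) dV_g(y) ≤ (1 + ε) ∫_{ℝᵐ} F(|v|) dv + Vol_g(M) F(r₀)` (layer-cake comparison on
the ball `{d < r₀}`, `F(d) ≤ F(r₀)` off it). [folklore] -/
theorem integral_comp_edist_le_of_ball_le {m : ℕ} {M : Type*} [TopologicalSpace M]
    [ChartedSpace (EuclideanSpace ℝ (Fin m)) M] [IsManifold 𝓘(ℝ, EuclideanSpace ℝ (Fin m)) ∞ M]
    [T2Space M] [CompactSpace M] [SecondCountableTopology M] [MeasurableSpace M] [BorelSpace M]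
    [ConnectedSpace M] [T3Space M]
    (g : PseudoRiemannianMetric 𝓘(ℝ, EuclideanSpace ℝ (Fin m)) ∞ (EuclideanSpace ℝ (Fin m))
      (TangentSpace 𝓘(ℝ, EuclideanSpace ℝ (Fin m)) : M → Type _)) (hg : g.IsRiemannian) (z : M)
    {F : ℝ → ℝ} (hF : Antitone F) (hF0 : ∀ r, 0 ≤ F r) (hFc : Continuous F)
    (hFi : Integrable (fun v : EuclideanSpace ℝ (Fin m) ↦ F ‖v‖)) {ε r₀ : ℝ} (hε : 0 ≤ ε)
    (hr₀ : 0 < r₀)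
    (hvol : ∀ r : ℝ, 0 < r → r ≤ r₀ →
      g.riemVolume.real {w | g.edist hg z w < ENNReal.ofReal r} ≤
        (1 + ε) * (volume (Metric.ball (0 : EuclideanSpace ℝ (Fin m)) r)).toReal) :
    ∫ y, F ((g.edist hg z y).toReal) ∂g.riemVolume ≤
      ((1 + ε) * ∫ v : EuclideanSpace ℝ (Fin m), F ‖v‖) + g.riemVolume.real univ * F r₀ := by
  haveI : IsFiniteMeasure g.riemVolume := ⟨g.riemVolume_univ_lt_top⟩
  set μ := g.riemVolume with hμ
  -- the (finite, real-valued) distance from `z`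
  set d : M → ℝ := fun y ↦ (g.edist hg z y).toReal with hd
  show ∫ y, F (d y) ∂μ ≤ (1 + ε) * (∫ v : EuclideanSpace ℝ (Fin m), F ‖v‖) + μ.real univ * F r₀
  have hd_nn : ∀ y, 0 ≤ d y := fun y ↦ ENNReal.toReal_nonneg
  have hd_meas : Measurable d :=
    ENNReal.measurable_toReal.comp
      ((PseudoRiemannianMetric.continuous_edist hg).comp (Continuous.prodMk_right z)).measurable
  have hball : ∀ c : ℝ, {y | d y < c} = {w | g.edist hg z w < ENNReal.ofReal c} := by
    intro c
    ext y
    exact (ENNReal.lt_ofReal_iff_toReal_lt (PseudoRiemannianMetric.edist_ne_top hg z y)).symm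
  -- the integrand truncated to the ball `{d < r₀}`
  set f : M → ℝ := {y | d y < r₀}.indicator fun y ↦ F (d y) with hf
  have hf_nn : ∀ y, 0 ≤ f y := fun y ↦ Set.indicator_nonneg (fun _ _ ↦ hF0 _) _
  have hf_meas : Measurable f :=
    (hFc.measurable.comp hd_meas).indicator (measurableSet_lt hd_meas measurable_const)
  have hpt : ∀ y, F (d y) ≤ f y + F r₀ := by
    intro y
    by_cases hy : d y < r₀
    · have hfy : f y = F (d y) := Set.indicator_of_mem (by exact hy) _
      rw [hfy]
      linarith [hF0 r₀]
    · have hfy : f y = 0 := Set.indicator_of_notMem (by exact hy) _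
      rw [hfy, zero_add]
      exact hF (le_of_not_gt hy)
  -- layer-cake comparison of the truncated integrand with the Euclidean radial integral
  have hkey : ∫⁻ y, ENNReal.ofReal (f y) ∂μ ≤
      ENNReal.ofReal (1 + ε) *
        ∫⁻ v, ENNReal.ofReal (F ‖v‖) ∂(volume : Measure (EuclideanSpace ℝ (Fin m))) := by
    rw [lintegral_eq_lintegral_meas_lt μ (Eventually.of_forall hf_nn) hf_meas.aemeasurable,
      lintegral_eq_lintegral_meas_lt volume (Eventually.of_forall fun v ↦ hF0 ‖v‖)
        hFi.aestronglyMeasurable.aemeasurable,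
      ← lintegral_const_mul' _ _ ENNReal.ofReal_ne_top]
    refine setLIntegral_mono' measurableSet_Ioi fun t ht ↦ ?_
    obtain ⟨c, hc, hiff⟩ := exists_forall_lt_and_lt_iff_lt hF hFc t hr₀.le
    calc μ {y | t < f y} ≤ μ {y | d y < c} := by
          refine measure_mono fun y hy ↦ ?_
          simp only [mem_setOf_eq] at hy ⊢
          by_cases hyr : d y < r₀
          · have hfy : f y = F (d y) := Set.indicator_of_mem (by exact hyr) _
            rw [hfy] at hy
            exact (hiff (d y) (hd_nn y)).1 ⟨hy, hyr⟩
          · have hfy : f y = 0 := Set.indicator_of_notMem (by exact hyr) _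
            rw [hfy] at hy
            exact absurd (mem_Ioi.1 ht) (not_lt.2 hy.le)
      _ ≤ ENNReal.ofReal (1 + ε) * volume (Metric.ball (0 : EuclideanSpace ℝ (Fin m)) c) := by
          rcases le_or_gt c 0 with hc0 | hc0
          · have hempty : {y | d y < c} = ∅ := by
              ext y
              simp only [mem_setOf_eq, mem_empty_iff_false, iff_false, not_lt]
              exact hc0.trans (hd_nn y)
            rw [hempty, measure_empty]
            exact zero_le
          · have h := hvol c hc0 hc
            rw [hball c]
            calc μ {w | g.edist hg z w < ENNReal.ofReal c}
                = ENNReal.ofReal (μ.real {w | g.edist hg z w < ENNReal.ofReal c}) := by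
                  rw [measureReal_def, ENNReal.ofReal_toReal (measure_ne_top _ _)]
              _ ≤ ENNReal.ofReal ((1 + ε) *
                    (volume (Metric.ball (0 : EuclideanSpace ℝ (Fin m)) c)).toReal) :=
                  ENNReal.ofReal_le_ofReal h
              _ = ENNReal.ofReal (1 + ε) * volume (Metric.ball (0 : EuclideanSpace ℝ (Fin m)) c) := by
                  rw [ENNReal.ofReal_mul (by linarith), ENNReal.ofReal_toReal measure_ball_lt_top.ne]
      _ ≤ ENNReal.ofReal (1 + ε) * volume {v : EuclideanSpace ℝ (Fin m) | t < F ‖v‖} := by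
          refine mul_le_mul_right (measure_mono fun v hv ↦ ?_) _
          exact ((hiff ‖v‖ (norm_nonneg v)).2 (mem_ball_zero_iff.1 hv)).1
  -- assemble: `∫ F ∘ d ≤ ∫ f + F r₀ Vol(M)` and convert back to real integrals
  have hI0 : 0 ≤ ∫ v : EuclideanSpace ℝ (Fin m), F ‖v‖ := integral_nonneg fun v ↦ hF0 _
  have hε1 : (0 : ℝ) ≤ 1 + ε := by linarith
  have hI : ENNReal.ofReal (∫ v : EuclideanSpace ℝ (Fin m), F ‖v‖) =
      ∫⁻ v, ENNReal.ofReal (F ‖v‖) ∂(volume : Measure (EuclideanSpace ℝ (Fin m))) :=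
    ofReal_integral_eq_lintegral_ofReal hFi (Eventually.of_forall fun v ↦ hF0 ‖v‖)
  have h1 : ∫⁻ y, ENNReal.ofReal (F (d y)) ∂μ ≤
      ENNReal.ofReal (1 + ε) * ENNReal.ofReal (∫ v : EuclideanSpace ℝ (Fin m), F ‖v‖) +
        ENNReal.ofReal (F r₀) * μ univ := by
    calc ∫⁻ y, ENNReal.ofReal (F (d y)) ∂μ
        ≤ ∫⁻ y, ENNReal.ofReal (f y) + ENNReal.ofReal (F r₀) ∂μ :=
          lintegral_mono fun y ↦ (ENNReal.ofReal_le_ofReal (hpt y)).trans ENNReal.ofReal_add_le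
      _ = ∫⁻ y, ENNReal.ofReal (f y) ∂μ + ENNReal.ofReal (F r₀) * μ univ := by
          rw [lintegral_add_right _ measurable_const, lintegral_const]
      _ ≤ _ := by
          rw [hI]
          exact add_le_add hkey le_rfl
  have hA : ENNReal.ofReal (1 + ε) * ENNReal.ofReal (∫ v : EuclideanSpace ℝ (Fin m), F ‖v‖) ≠ ⊤ :=
    ENNReal.mul_ne_top ENNReal.ofReal_ne_top ENNReal.ofReal_ne_top
  have hB : ENNReal.ofReal (F r₀) * μ univ ≠ ⊤ :=
    ENNReal.mul_ne_top ENNReal.ofReal_ne_top (measure_ne_top _ _)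
  have hmeasF : AEStronglyMeasurable (fun y ↦ F (d y)) μ :=
    (hFc.measurable.comp hd_meas).aestronglyMeasurable
  rw [integral_eq_lintegral_of_nonneg_ae (Eventually.of_forall fun y ↦ hF0 (d y)) hmeasF]
  refine (ENNReal.toReal_mono (ENNReal.add_ne_top.2 ⟨hA, hB⟩) h1).trans_eq ?_
  rw [ENNReal.toReal_add hA hB, ENNReal.toReal_mul, ENNReal.toReal_mul, ENNReal.toReal_ofReal hε1,
    ENNReal.toReal_ofReal hI0, ENNReal.toReal_ofReal (hF0 r₀), ← measureReal_def]
  ring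

end Literature.Geometry.Riemannian
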